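import Mathlib
import Literature.NumberTheory.Sieve.VaughanMeanValue

/-!
# Knife-edge annex (F-S2, seat transfer): the invisible tail — proved engine

WHAT THIS IS NOT: not a claim about Theorems 1–2 of arXiv:2211.02515, about Landau–Siegel zeros, or about
Parity.  This file banks the two PROVED, assumption-free pieces behind the F-S2 transfer card
«invisible tail» (cell `zhang-knife`, `CARD-invisible-tail.md`); the card's candidate estimates
(`TailBoundSmooth`, `TailInvisible`, `DiscMeanFlat`, `Eq711Long`, …) are NOT in this file and are not claimed.

**Mechanism (card §1).**  In Zhang's discrete mean over the sampled zeros `ρ ∈ 𝔷(ψ)`, `ψ ∈ Ψ₁`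
(arXiv:2211.02515 §7–§8), a coefficient polynomial of the smooth class `χψ(n) g(log n/log P) n^{−ρ}` has its
block beyond `P^{1+ε}` bounded POINTWISE by a complete character sum: `χψ` is primitive to the modulus
`pD = P^{1+o(1)}`, so Pólya–Vinogradov plus Abel summation bounds the block `(X, Y]` by
`√(pD) log(pD) · (sup + total variation of the weight)`, and for `X ≥ P^{1+ε} ≫ pD·t₀` this is `P^{−ε/4}`-small.
The two lemmas here are the engine of that remark:

* `norm_sum_Ioc_char_mul_le` — **Pólya–Vinogradov with general weights**: for `θ` primitive mod `q ≥ 2`,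
  any `b : ℕ → ℂ`, `X ≤ Y`, `sup_{(X,Y]} ‖b‖ ≤ B`, `Σ_{X≤n<Y} ‖b(n+1) − b(n)‖ ≤ V` (`B, V ≥ 0`):
  `‖Σ_{X<n≤Y} θ(n) b(n)‖ ≤ √q (1 + log q) (B + V)` (from the tree's `Vaughan.norm_sum_Ioc_char_le`, i.e.
  `LargeSieve.polyaVinogradov`, by Abel summation); packaged as `tailBoundPV` (the card's Prop `TailBoundPV` verbatim, constant 3);
* `norm_sum_Ioc_char_profile_cpow_le` — **the smooth-class tail bound with all bookkeeping**: for `g` 1-Lipschitz,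
  `‖g‖ ≤ 1`, `L > 0`, `Re s > 0`, `1 ≤ X ≤ Y`:
  `‖Σ_{X<n≤Y} θ(n) g(log n/L) n^{−s}‖ ≤ √q(1+log q)·X^{−Re s}·(1 + (log Y − log X)/L + ‖s‖(1 + 1/Re s))`
  (MVT for `u ↦ u^{−s}`: `norm_natCast_succ_cpow_sub_le`; sum–integral comparison: `sum_Ico_rpow_neg_le`; telescoping
  of the profile: `sum_Ico_norm_profile_sub_le`);
* `abs_sum_mul_norm_sq_perturb_le` — **flatness of a weighted discrete mean under a pointwise-small
  perturbation**: `|Σ w_i(‖a_i + t_i‖² − ‖a_i‖²)| ≤ η Σ|w_i|‖a_i‖² + (τ²/η + τ²) Σ|w_i|` whenever `‖t_i‖ ≤ τ`,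
  `η > 0` (the deterministic step «invisible tail ⇒ the main term is constant in the length beyond θ = 1»).

[cite: MontgomeryVaughan2007, Thm 9.18; CojocaruMurty2005, (8.14); Zhang2022LandauSiegel, §7 (7.2), §8 Lemma 8.1]
-/

namespace Literature.NumberTheory.LFunctions.Zhang2022.KnifeEdgeInvisibleTail

open Finset

/-- Telescoping on `Ico n Y` in an additive group: `Σ_{n ≤ m < Y} (b(m+1) − b(m)) = b(Y) − b(n)`
for `n ≤ Y`. [folklore] -/
private theorem sum_Ico_sub_succ {M : Type*} [AddCommGroup M] (b : ℕ → M) {n Y : ℕ} (h : n ≤ Y) :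
    ∑ m ∈ Ico n Y, (b (m + 1) - b m) = b Y - b n := by
  rw [Finset.sum_Ico_eq_sum_range]
  have : ∀ k ∈ range (Y - n), b (n + k + 1) - b (n + k) =
      (fun k => b (n + k)) (k + 1) - (fun k => b (n + k)) k := fun k _ => rfl
  rw [sum_congr rfl this, Finset.sum_range_sub (fun k => b (n + k))]
  simp [Nat.add_sub_cancel' h]

/-- **Pólya–Vinogradov + Abel summation with general weights** (sup + total variation).
[cite: MontgomeryVaughan2007, Thm 9.18; CojocaruMurty2005, (8.14)] -/
theorem norm_sum_Ioc_char_mul_le {q : ℕ} (hq : 2 ≤ q) {θ : DirichletCharacter ℂ q}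
    (hθ : θ.IsPrimitive) (b : ℕ → ℂ) {X Y : ℕ} (hXY : X ≤ Y) {B V : ℝ} (hB : 0 ≤ B) (hV : 0 ≤ V)
    (hb : ∀ n ∈ Ioc X Y, ‖b n‖ ≤ B) (hv : ∑ n ∈ Ico X Y, ‖b (n + 1) - b n‖ ≤ V) :
    ‖∑ n ∈ Ioc X Y, θ n * b n‖ ≤ Real.sqrt q * (1 + Real.log q) * (B + V) := by
  set M : ℝ := Real.sqrt q * (1 + Real.log q) with hMdef
  have hlogq : 0 ≤ Real.log q := Real.log_natCast_nonneg q
  have hM : 0 ≤ M := by positivity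
  have hS : ∀ A A' : ℕ, ‖∑ m ∈ Ioc A A', θ m‖ ≤ M :=
    fun A A' => Literature.NumberTheory.Sieve.Vaughan.norm_sum_Ioc_char_le hq hθ A A'
  rcases eq_or_lt_of_le hXY with rfl | hlt
  · simp only [Finset.Ioc_self, sum_empty, norm_zero]
    positivity
  -- Abel: b n = b Y - Σ_{m ∈ Ico n Y} (b(m+1) - b m)
  have h1 : ∑ n ∈ Ioc X Y, θ n * b n =
      b Y * ∑ n ∈ Ioc X Y, θ n -
        ∑ n ∈ Ioc X Y, ∑ m ∈ Ico n Y, θ n * (b (m + 1) - b m) := by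
    rw [mul_sum, ← sum_sub_distrib]
    refine sum_congr rfl fun n hn => ?_
    have hnY : n ≤ Y := (mem_Ioc.1 hn).2
    rw [← mul_sum, sum_Ico_sub_succ b hnY]
    ring
  have h2 : ∑ n ∈ Ioc X Y, ∑ m ∈ Ico n Y, θ n * (b (m + 1) - b m) =
      ∑ m ∈ Ico (X + 1) Y, (b (m + 1) - b m) * ∑ n ∈ Ioc X m, θ n := by
    rw [Finset.sum_comm' (t' := Ico (X + 1) Y) (s' := fun m => Ioc X m)]
    · exact sum_congr rfl fun m _ => by rw [mul_sum]; exact sum_congr rfl fun n _ => by ring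
    · intro n m
      simp only [mem_Ioc, mem_Ico]
      omega
  rw [h1, h2]
  have hY : Y ∈ Ioc X Y := by simp [hlt]
  calc ‖b Y * ∑ n ∈ Ioc X Y, θ n -
        ∑ m ∈ Ico (X + 1) Y, (b (m + 1) - b m) * ∑ n ∈ Ioc X m, θ n‖
      ≤ ‖b Y * ∑ n ∈ Ioc X Y, θ n‖ +
        ‖∑ m ∈ Ico (X + 1) Y, (b (m + 1) - b m) * ∑ n ∈ Ioc X m, θ n‖ := norm_sub_le _ _
    _ ≤ B * M + ∑ m ∈ Ico (X + 1) Y, ‖b (m + 1) - b m‖ * M := by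
        gcongr
        · rw [norm_mul]
          exact mul_le_mul (hb Y hY) (hS X Y) (norm_nonneg _) hB
        · refine (norm_sum_le _ _).trans (sum_le_sum fun m _ => ?_)
          rw [norm_mul]
          exact mul_le_mul_of_nonneg_left (hS X m) (norm_nonneg _)
    _ ≤ B * M + V * M := by
        rw [← sum_mul]
        gcongr
        refine le_trans ?_ hv
        refine sum_le_sum_of_subset_of_nonneg (fun m hm => ?_) fun _ _ _ => norm_nonneg _
        simp only [mem_Ico] at hm ⊢
        omega
    _ = M * (B + V) := by ring

/-- **Pólya–Vinogradov + Abel, packaged** (literally the Prop `TailBoundPV` of the F-S2 transfer card's `Sketch.lean`,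
now a theorem, constant `C = 3`): for every primitive `θ mod q`, `q > 1`, every weight `b` and block `(X, Y]` with
`sup ‖b‖ ≤ B`, variation `≤ V` (`B, V ≥ 0`): `‖Σ_{X<n≤Y} θ(n)b(n)‖ ≤ C √q log q (B + V)`.
[cite: MontgomeryVaughan2007, Thm 9.18] -/
theorem tailBoundPV :
    ∃ C : ℝ, 0 < C ∧ ∀ (q : ℕ) [NeZero q] (θ : DirichletCharacter ℂ q), 1 < q → θ.IsPrimitive →
      ∀ (b : ℕ → ℂ) (X Y : ℕ) (B V : ℝ), X ≤ Y → 0 ≤ B → 0 ≤ V →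
        (∀ n ∈ Finset.Ioc X Y, ‖b n‖ ≤ B) →
        (∑ n ∈ Finset.Ico X Y, ‖b (n + 1) - b n‖) ≤ V →
        ‖∑ n ∈ Finset.Ioc X Y, θ (n : ZMod q) * b n‖ ≤ C * Real.sqrt q * Real.log q * (B + V) := by
  refine ⟨3, by norm_num, ?_⟩
  intro q _ θ hq hθ b X Y B V hXY hB hV hb hv
  have hq2 : 2 ≤ q := hq
  have h := norm_sum_Ioc_char_mul_le hq2 hθ b hXY hB hV hb hv
  refine h.trans ?_
  have hlog2 : (1 : ℝ) / 2 ≤ Real.log q := by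
    have h2 : Real.log 2 ≤ Real.log q :=
      Real.log_le_log (by norm_num) (by exact_mod_cast hq2)
    linarith [Real.log_two_gt_d9]
  have hsq : 0 ≤ Real.sqrt q := Real.sqrt_nonneg _
  have hBV : 0 ≤ B + V := add_nonneg hB hV
  have : Real.sqrt q * (1 + Real.log q) ≤ 3 * Real.sqrt q * Real.log q := by
    have : 1 + Real.log q ≤ 3 * Real.log q := by linarith
    calc Real.sqrt q * (1 + Real.log q) ≤ Real.sqrt q * (3 * Real.log q) :=
          mul_le_mul_of_nonneg_left this hsq
      _ = 3 * Real.sqrt q * Real.log q := by ring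
  exact mul_le_mul_of_nonneg_right this hBV

/-- MVT step: `‖(n+1)^{-s} − n^{-s}‖ ≤ ‖s‖ · n^{-σ-1}` for `n ≥ 1`, `s ≠ 0`, `σ = Re s ≥ -1`. [folklore] -/
private theorem norm_natCast_succ_cpow_sub_le {n : ℕ} (hn : 1 ≤ n) {s : ℂ} (hs : s ≠ 0) (hσ : -1 ≤ s.re) :
    ‖((n + 1 : ℕ) : ℂ) ^ (-s) - (n : ℂ) ^ (-s)‖ ≤ ‖s‖ * (n : ℝ) ^ (-s.re - 1) := by
  have hn0 : (0 : ℝ) < n := by exact_mod_cast hn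
  have hderiv : ∀ y ∈ Set.Icc (n : ℝ) (n + 1),
      HasDerivWithinAt (fun y : ℝ => (y : ℂ) ^ (-s)) (-s * (y : ℂ) ^ (-s - 1))
        (Set.Icc (n : ℝ) (n + 1)) y := by
    intro y hy
    have hy0 : y ≠ 0 := by linarith [hy.1]
    exact (hasDerivAt_ofReal_cpow_const hy0 (neg_ne_zero.2 hs)).hasDerivWithinAt
  have hbound : ∀ y ∈ Set.Ico (n : ℝ) (n + 1),
      ‖-s * (y : ℂ) ^ (-s - 1)‖ ≤ ‖s‖ * (n : ℝ) ^ (-s.re - 1) := by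
    intro y hy
    have hy0 : 0 < y := by linarith [hy.1]
    rw [norm_mul, norm_neg, Complex.norm_cpow_eq_rpow_re_of_pos hy0]
    have hre : (-s - 1).re = -s.re - 1 := by simp
    rw [hre]
    refine mul_le_mul_of_nonneg_left ?_ (norm_nonneg _)
    exact Real.rpow_le_rpow_of_nonpos hn0 hy.1 (by linarith)
  have key := norm_image_sub_le_of_norm_deriv_le_segment' hderiv hbound (n + 1)
    (Set.right_mem_Icc.2 (by linarith))
  have hcast : (((n + 1 : ℕ) : ℂ)) = (((n : ℝ) + 1 : ℝ) : ℂ) := by push_cast; ring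
  have hcast2 : ((n : ℕ) : ℂ) = ((n : ℝ) : ℂ) := by push_cast; ring
  rw [hcast, hcast2]
  simpa using key

/-- `Σ_{X ≤ n < Y} n^{-σ-1} ≤ (1 + 1/σ) X^{-σ}` for `1 ≤ X ≤ Y`, `σ > 0` (sum–integral comparison). [folklore] -/
private theorem sum_Ico_rpow_neg_le {X Y : ℕ} (hX : 1 ≤ X) (hXY : X ≤ Y) {σ : ℝ} (hσ : 0 < σ) :
    ∑ n ∈ Ico X Y, (n : ℝ) ^ (-σ - 1) ≤ (1 + 1 / σ) * (X : ℝ) ^ (-σ) := by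
  have hX0 : (0 : ℝ) < X := by exact_mod_cast hX
  have hXσ : 0 ≤ (X : ℝ) ^ (-σ) := Real.rpow_nonneg hX0.le _
  rcases eq_or_lt_of_le hXY with rfl | hlt
  · simp only [Finset.Ico_self, sum_empty]
    positivity
  have hY1 : 1 ≤ Y := hX.trans hXY
  rw [Finset.sum_eq_sum_Ico_succ_bot hlt]
  -- first term
  have h1 : (X : ℝ) ^ (-σ - 1) ≤ (X : ℝ) ^ (-σ) :=
    Real.rpow_le_rpow_of_exponent_le (by exact_mod_cast hX) (by linarith)
  -- remaining terms vs integral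
  have hanti : AntitoneOn (fun x : ℝ => x ^ (-σ - 1)) (Set.Icc (X : ℝ) ((Y - 1 : ℕ) : ℝ)) := by
    refine (Real.antitoneOn_rpow_Ioi_of_exponent_nonpos (by linarith : -σ - 1 ≤ 0)).mono ?_
    intro x hx
    exact lt_of_lt_of_le hX0 hx.1
  have hXY1 : X ≤ Y - 1 := by omega
  have h2 := AntitoneOn.sum_le_integral_Ico hXY1 hanti
  -- `Σ_{i ∈ Ico X (Y-1)} f(i+1) = Σ_{n ∈ Ico (X+1) Y} f n`
  have hreindex : ∑ i ∈ Ico X (Y - 1), (((i + 1 : ℕ) : ℝ)) ^ (-σ - 1) =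
      ∑ n ∈ Ico (X + 1) Y, (n : ℝ) ^ (-σ - 1) := by
    rw [Finset.sum_Ico_add' (fun n : ℕ => (n : ℝ) ^ (-σ - 1)) X (Y - 1) 1, Nat.sub_add_cancel hY1]
  rw [hreindex] at h2
  -- evaluate the integral
  have hY1r : ((Y - 1 : ℕ) : ℝ) = (Y : ℝ) - 1 := by
    rw [Nat.cast_sub hY1]; simp
  have hint : ∫ x in (X : ℝ)..((Y - 1 : ℕ) : ℝ), x ^ (-σ - 1) =
      ((((Y - 1 : ℕ) : ℝ)) ^ (-σ) - (X : ℝ) ^ (-σ)) / (-σ) := by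
    have h0 : (0 : ℝ) ∉ Set.uIcc (X : ℝ) ((Y - 1 : ℕ) : ℝ) := by
      refine Set.notMem_uIcc_of_lt hX0 ?_
      rw [hY1r]
      have : (2 : ℝ) ≤ Y := by exact_mod_cast (by omega : 2 ≤ Y)
      linarith
    rw [integral_rpow (Or.inr ⟨by linarith, h0⟩)]
    congr 1 <;> [skip; ring]
    have : -σ - 1 + 1 = -σ := by ring
    rw [this]
  have hYσ : 0 ≤ (((Y - 1 : ℕ) : ℝ)) ^ (-σ) := Real.rpow_nonneg (by positivity) _
  have h3 : ∫ x in (X : ℝ)..((Y - 1 : ℕ) : ℝ), x ^ (-σ - 1) ≤ (X : ℝ) ^ (-σ) / σ := by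
    rw [hint]
    have : ((((Y - 1 : ℕ) : ℝ)) ^ (-σ) - (X : ℝ) ^ (-σ)) / (-σ) =
        ((X : ℝ) ^ (-σ) - (((Y - 1 : ℕ) : ℝ)) ^ (-σ)) / σ := by
      field_simp
      ring
    rw [this]
    exact div_le_div_of_nonneg_right (by linarith) hσ.le
  calc (X : ℝ) ^ (-σ - 1) + ∑ n ∈ Ico (X + 1) Y, (n : ℝ) ^ (-σ - 1)
      ≤ (X : ℝ) ^ (-σ) + (X : ℝ) ^ (-σ) / σ := add_le_add h1 (h2.trans h3)
    _ = (1 + 1 / σ) * (X : ℝ) ^ (-σ) := by ring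

/-- Variation of the Lipschitz profile along `zₙ = log n / L`: telescoping. [folklore] -/
private theorem sum_Ico_norm_profile_sub_le {g : ℝ → ℂ} (hg : LipschitzWith 1 g) {L : ℝ} (hL : 0 < L)
    {X Y : ℕ} (hX : 1 ≤ X) (hXY : X ≤ Y) :
    ∑ n ∈ Ico X Y, ‖g (Real.log (n + 1 : ℕ) / L) - g (Real.log n / L)‖ ≤
      (Real.log Y - Real.log X) / L := by
  have hstep : ∀ n ∈ Ico X Y, ‖g (Real.log (n + 1 : ℕ) / L) - g (Real.log n / L)‖ ≤
      Real.log (n + 1 : ℕ) / L - Real.log n / L := by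
    intro n hn
    have hn1 : (1 : ℝ) ≤ n := by exact_mod_cast (hX.trans (mem_Ico.1 hn).1)
    have hmono : Real.log n / L ≤ Real.log (n + 1 : ℕ) / L := by
      refine div_le_div_of_nonneg_right ?_ hL.le
      exact Real.log_le_log (by linarith) (by push_cast; linarith)
    have := hg.dist_le_mul (Real.log (n + 1 : ℕ) / L) (Real.log n / L)
    rw [dist_eq_norm, Real.dist_eq, NNReal.coe_one, one_mul, abs_of_nonneg (by linarith)] at this
    exact this
  refine (sum_le_sum hstep).trans ?_
  rw [sum_Ico_sub_succ (fun n : ℕ => Real.log n / L) hXY]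
  ring_nf
  rfl

/-- **Tail of a smooth-profile character polynomial** (Pólya–Vinogradov + Abel, bookkeeping included):
for `θ` primitive mod `q ≥ 2`, `g` 1-Lipschitz with `‖g‖ ≤ 1`, `L > 0`, `Re s > 0`, `1 ≤ X ≤ Y`,
`‖Σ_{X<n≤Y} θ(n) g(log n/L) n^{−s}‖ ≤ √q(1+log q) · X^{−Re s} · (1 + (log Y − log X)/L + ‖s‖(1 + 1/Re s))`.
With `θ = χψ mod q = pD ≤ 2PD`, `L = log P`, `Re s ≥ ½ − 1/log P`, `|s| ≤ 8t₀ + 2`, `X ≥ P^{1+ε}`, `Y ≤ P^{1+δ}` the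
right side is `P^{−ε/2+o(1)}`: the «invisible tail» of the F-S2 transfer card for the smooth coefficient class (what is
NOT done here: identifying `Skeleton.pc χ x` with a primitive character mod `pD`). [cite: MontgomeryVaughan2007, Thm 9.18] -/
theorem norm_sum_Ioc_char_profile_cpow_le {q : ℕ} (hq : 2 ≤ q) {θ : DirichletCharacter ℂ q}
    (hθ : θ.IsPrimitive) {g : ℝ → ℂ} (hg : LipschitzWith 1 g) (hg1 : ∀ z, ‖g z‖ ≤ 1)
    {L : ℝ} (hL : 0 < L) {s : ℂ} (hσ : 0 < s.re) {X Y : ℕ} (hX : 1 ≤ X) (hXY : X ≤ Y) :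
    ‖∑ n ∈ Ioc X Y, θ n * (g (Real.log n / L) * (n : ℂ) ^ (-s))‖ ≤
      Real.sqrt q * (1 + Real.log q) * ((X : ℝ) ^ (-s.re) *
        (1 + (Real.log Y - Real.log X) / L + ‖s‖ * (1 + 1 / s.re))) := by
  have hX0 : (0 : ℝ) < X := by exact_mod_cast hX
  have hs0 : s ≠ 0 := by
    intro h; rw [h] at hσ; simp at hσ
  set B : ℝ := (X : ℝ) ^ (-s.re) with hB
  have hB0 : 0 ≤ B := Real.rpow_nonneg hX0.le _
  have hlogXY : 0 ≤ (Real.log Y - Real.log X) / L := by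
    refine div_nonneg ?_ hL.le
    have := Real.log_le_log hX0 (by exact_mod_cast hXY : (X : ℝ) ≤ Y)
    linarith
  set V : ℝ := B * ((Real.log Y - Real.log X) / L + ‖s‖ * (1 + 1 / s.re)) with hV
  have hV0 : 0 ≤ V := by positivity
  -- pointwise size of n^{-s}
  have hnpow : ∀ n : ℕ, X ≤ n → ‖(n : ℂ) ^ (-s)‖ ≤ B := by
    intro n hn
    have hn0 : 0 < n := by omega
    rw [Complex.norm_natCast_cpow_of_pos hn0, Complex.neg_re]
    exact Real.rpow_le_rpow_of_nonpos hX0 (by exact_mod_cast hn) (by linarith)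
  have hsup : ∀ n ∈ Ioc X Y, ‖g (Real.log n / L) * (n : ℂ) ^ (-s)‖ ≤ B := by
    intro n hn
    rw [norm_mul]
    calc ‖g (Real.log n / L)‖ * ‖(n : ℂ) ^ (-s)‖ ≤ 1 * B :=
          mul_le_mul (hg1 _) (hnpow n (mem_Ioc.1 hn).1.le) (norm_nonneg _) zero_le_one
      _ = B := one_mul B
  have hvar : ∑ n ∈ Ico X Y, ‖g (Real.log (n + 1 : ℕ) / L) * ((n + 1 : ℕ) : ℂ) ^ (-s) -
      g (Real.log n / L) * (n : ℂ) ^ (-s)‖ ≤ V := by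
    have hpt : ∀ n ∈ Ico X Y, ‖g (Real.log (n + 1 : ℕ) / L) * ((n + 1 : ℕ) : ℂ) ^ (-s) -
        g (Real.log n / L) * (n : ℂ) ^ (-s)‖ ≤
        B * ‖g (Real.log (n + 1 : ℕ) / L) - g (Real.log n / L)‖ +
          ‖s‖ * (n : ℝ) ^ (-s.re - 1) := by
      intro n hn
      have hXn : X ≤ n := (mem_Ico.1 hn).1
      have hn1 : 1 ≤ n := hX.trans hXn
      have hsplit : g (Real.log (n + 1 : ℕ) / L) * ((n + 1 : ℕ) : ℂ) ^ (-s) -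
          g (Real.log n / L) * (n : ℂ) ^ (-s) =
          (g (Real.log (n + 1 : ℕ) / L) - g (Real.log n / L)) * ((n + 1 : ℕ) : ℂ) ^ (-s) +
            g (Real.log n / L) * (((n + 1 : ℕ) : ℂ) ^ (-s) - (n : ℂ) ^ (-s)) := by ring
      rw [hsplit]
      refine (norm_add_le _ _).trans (add_le_add ?_ ?_)
      · rw [norm_mul, mul_comm]
        exact mul_le_mul_of_nonneg_right (hnpow (n + 1) (by omega)) (norm_nonneg _)
      · rw [norm_mul]
        calc ‖g (Real.log n / L)‖ * ‖((n + 1 : ℕ) : ℂ) ^ (-s) - (n : ℂ) ^ (-s)‖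
            ≤ 1 * (‖s‖ * (n : ℝ) ^ (-s.re - 1)) :=
              mul_le_mul (hg1 _) (norm_natCast_succ_cpow_sub_le hn1 hs0 (by linarith))
                (norm_nonneg _) zero_le_one
          _ = ‖s‖ * (n : ℝ) ^ (-s.re - 1) := one_mul _
    refine (sum_le_sum hpt).trans ?_
    rw [sum_add_distrib, ← mul_sum, ← mul_sum]
    have hA := sum_Ico_norm_profile_sub_le hg hL hX hXY
    have hC := sum_Ico_rpow_neg_le hX hXY hσ
    calc B * ∑ n ∈ Ico X Y, ‖g (Real.log (n + 1 : ℕ) / L) - g (Real.log n / L)‖ +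
          ‖s‖ * ∑ n ∈ Ico X Y, (n : ℝ) ^ (-s.re - 1)
        ≤ B * ((Real.log Y - Real.log X) / L) + ‖s‖ * ((1 + 1 / s.re) * (X : ℝ) ^ (-s.re)) :=
          add_le_add (mul_le_mul_of_nonneg_left hA hB0) (mul_le_mul_of_nonneg_left hC (norm_nonneg _))
      _ = V := by rw [hV, hB]; ring
  have := norm_sum_Ioc_char_mul_le hq hθ (fun n => g (Real.log n / L) * (n : ℂ) ^ (-s))
    hXY hB0 hV0 hsup hvar
  refine this.trans (le_of_eq ?_)
  rw [hV, hB]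
  ring

/-- Pointwise: `|‖a + t‖² − ‖a‖²| ≤ η‖a‖² + ‖t‖²/η + ‖t‖²` for `η > 0` (polarisation + AM–GM). [folklore] -/
private theorem abs_norm_add_sq_sub_norm_sq_le (a t : ℂ) {η : ℝ} (hη : 0 < η) :
    |‖a + t‖ ^ 2 - ‖a‖ ^ 2| ≤ η * ‖a‖ ^ 2 + ‖t‖ ^ 2 / η + ‖t‖ ^ 2 := by
  have hid : ‖a + t‖ ^ 2 - ‖a‖ ^ 2 = 2 * (a * (starRingEnd ℂ) t).re + ‖t‖ ^ 2 := by
    rw [Complex.sq_norm, Complex.sq_norm, Complex.sq_norm, Complex.normSq_add]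
    ring
  have hre : |(a * (starRingEnd ℂ) t).re| ≤ ‖a‖ * ‖t‖ := by
    calc |(a * (starRingEnd ℂ) t).re| ≤ ‖a * (starRingEnd ℂ) t‖ := Complex.abs_re_le_norm _
      _ = ‖a‖ * ‖t‖ := by rw [norm_mul, Complex.norm_conj]
  have ha : 0 ≤ ‖a‖ := norm_nonneg _
  have ht : 0 ≤ ‖t‖ := norm_nonneg _
  have hamgm : 2 * (‖a‖ * ‖t‖) ≤ η * ‖a‖ ^ 2 + ‖t‖ ^ 2 / η := by
    have h1 : 0 ≤ (η * ‖a‖ - ‖t‖) ^ 2 / η := div_nonneg (sq_nonneg _) hη.le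
    have h2 : (η * ‖a‖ - ‖t‖) ^ 2 / η = η * ‖a‖ ^ 2 - 2 * (‖a‖ * ‖t‖) + ‖t‖ ^ 2 / η := by
      field_simp
      ring
    linarith
  rw [hid]
  have := abs_le.1 (show |(a * (starRingEnd ℂ) t).re| ≤ ‖a‖ * ‖t‖ from hre)
  rw [abs_le]
  constructor <;> nlinarith [sq_nonneg ‖t‖, this.1, this.2, hamgm, div_nonneg (sq_nonneg ‖t‖) hη.le]

/-- **Flatness of a weighted discrete mean under a pointwise-small perturbation** (deterministic):
if `‖t i‖ ≤ τ` on `s`, then for every `η > 0`,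
`|Σ w_i (‖a_i + t_i‖² − ‖a_i‖²)| ≤ η Σ|w_i|‖a_i‖² + (τ²/η + τ²) Σ|w_i|`.
(With `τ = C·P^{−ε/4}`, `η = P^{−ε/8}`: the deterministic step «invisible tail ⇒ flat main term» for the discrete mean
`Σ_ψ Σ_ρ 𝔠*(ρ,ψ)|A|²ω(ρ)` of Zhang's Lemma 8.1.) [cite: Zhang2022LandauSiegel, §8 Lemma 8.1] -/
theorem abs_sum_mul_norm_sq_perturb_le {ι : Type*} (s : Finset ι) (w : ι → ℝ) (a t : ι → ℂ)
    {η τ : ℝ} (hη : 0 < η) (hτ : ∀ i ∈ s, ‖t i‖ ≤ τ) :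
    |∑ i ∈ s, w i * (‖a i + t i‖ ^ 2 - ‖a i‖ ^ 2)| ≤
      η * ∑ i ∈ s, |w i| * ‖a i‖ ^ 2 + (τ ^ 2 / η + τ ^ 2) * ∑ i ∈ s, |w i| := by
  calc |∑ i ∈ s, w i * (‖a i + t i‖ ^ 2 - ‖a i‖ ^ 2)|
      ≤ ∑ i ∈ s, |w i * (‖a i + t i‖ ^ 2 - ‖a i‖ ^ 2)| := abs_sum_le_sum_abs _ _
    _ ≤ ∑ i ∈ s, |w i| * (η * ‖a i‖ ^ 2 + τ ^ 2 / η + τ ^ 2) := by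
        refine sum_le_sum fun i hi => ?_
        rw [abs_mul]
        refine mul_le_mul_of_nonneg_left ?_ (abs_nonneg _)
        refine (abs_norm_add_sq_sub_norm_sq_le (a i) (t i) hη).trans ?_
        have hti : ‖t i‖ ≤ τ := hτ i hi
        have ht0 : 0 ≤ ‖t i‖ := norm_nonneg _
        have hsq : ‖t i‖ ^ 2 ≤ τ ^ 2 := pow_le_pow_left₀ ht0 hti 2
        have hdiv : ‖t i‖ ^ 2 / η ≤ τ ^ 2 / η := div_le_div_of_nonneg_right hsq hη.le
        linarith
    _ = η * ∑ i ∈ s, |w i| * ‖a i‖ ^ 2 + (τ ^ 2 / η + τ ^ 2) * ∑ i ∈ s, |w i| := by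
        rw [mul_sum, mul_sum, ← sum_add_distrib]
        exact sum_congr rfl fun i _ => by ring

/-! ## E. Profiles of bounded variation (arbitrary jumps) — engine for the non-smooth class (LS programme §B-multi)

The Abel step of `norm_sum_Ioc_char_profile_cpow_le` sees the profile only through `sup ‖g‖` and its DISCRETE
variation `Σ_{X≤n<Y} ‖g(z_{n+1}) − g(z_n)‖` along the sample points `z_n = log n / L`; for a profile of bounded
variation on the block (finitely many jumps, piecewise smooth — the piecewise class of the §A evaluator) that
discrete variation is at most the total variation (`eVariationOn`).  So the far block `n > P^{1+ε}` of ANY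
bounded-variation coefficient profile is as invisible as a smooth one: no smoothness at or beyond the wall is used.
(Cell `landau-siegel`, family B-multi, registry row «E-multi-farjump»; packaged over Zhang's family in
`KnifeEdgeInvisibleTailFamily.tailInvisible_bv`.) -/

/-- **Tail of a bounded-variation-profile character polynomial** (Pólya–Vinogradov + Abel; jumps allowed).
For `θ` primitive mod `q ≥ 2`, any `g : ℝ → ℂ` with `‖g‖ ≤ B`, any `L`, `Re s > 0`, `1 ≤ X ≤ Y`, and discrete
variation `Σ_{X≤n<Y} ‖g(log(n+1)/L) − g(log n/L)‖ ≤ V` (`B, V ≥ 0`):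
`‖Σ_{X<n≤Y} θ(n) g(log n/L) n^{−s}‖ ≤ √q(1+log q) · X^{−Re s} · (B(1 + ‖s‖(1 + 1/Re s)) + V)`.
(For `g` 1-Lipschitz with `‖g‖ ≤ 1`: `B = 1`, `V = (log Y − log X)/L` is `norm_sum_Ioc_char_profile_cpow_le`.)
[cite: MontgomeryVaughan2007, Thm 9.18] -/
theorem norm_sum_Ioc_char_bvProfile_cpow_le {q : ℕ} (hq : 2 ≤ q) {θ : DirichletCharacter ℂ q}
    (hθ : θ.IsPrimitive) (g : ℝ → ℂ) {B V : ℝ} (hB : 0 ≤ B) (hV : 0 ≤ V) (hgB : ∀ z, ‖g z‖ ≤ B)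
    (L : ℝ) {s : ℂ} (hσ : 0 < s.re) {X Y : ℕ} (hX : 1 ≤ X) (hXY : X ≤ Y)
    (hvar : ∑ n ∈ Ico X Y, ‖g (Real.log (n + 1 : ℕ) / L) - g (Real.log n / L)‖ ≤ V) :
    ‖∑ n ∈ Ioc X Y, θ n * (g (Real.log n / L) * (n : ℂ) ^ (-s))‖ ≤
      Real.sqrt q * (1 + Real.log q) * ((X : ℝ) ^ (-s.re) *
        (B * (1 + ‖s‖ * (1 + 1 / s.re)) + V)) := by
  have hX0 : (0 : ℝ) < X := by exact_mod_cast hX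
  have hs0 : s ≠ 0 := by
    intro h; rw [h] at hσ; simp at hσ
  set A : ℝ := (X : ℝ) ^ (-s.re) with hA
  have hA0 : 0 ≤ A := Real.rpow_nonneg hX0.le _
  have hAB : 0 ≤ B * A := mul_nonneg hB hA0
  set W : ℝ := A * (V + B * (‖s‖ * (1 + 1 / s.re))) with hW
  have hW0 : 0 ≤ W := by positivity
  -- pointwise size of n^{-s}
  have hnpow : ∀ n : ℕ, X ≤ n → ‖(n : ℂ) ^ (-s)‖ ≤ A := by
    intro n hn
    have hn0 : 0 < n := by omega
    rw [Complex.norm_natCast_cpow_of_pos hn0, Complex.neg_re]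
    exact Real.rpow_le_rpow_of_nonpos hX0 (by exact_mod_cast hn) (by linarith)
  have hsup : ∀ n ∈ Ioc X Y, ‖g (Real.log n / L) * (n : ℂ) ^ (-s)‖ ≤ B * A := by
    intro n hn
    rw [norm_mul]
    exact mul_le_mul (hgB _) (hnpow n (mem_Ioc.1 hn).1.le) (norm_nonneg _) hB
  have hvar' : ∑ n ∈ Ico X Y, ‖g (Real.log (n + 1 : ℕ) / L) * ((n + 1 : ℕ) : ℂ) ^ (-s) -
      g (Real.log n / L) * (n : ℂ) ^ (-s)‖ ≤ W := by
    have hpt : ∀ n ∈ Ico X Y, ‖g (Real.log (n + 1 : ℕ) / L) * ((n + 1 : ℕ) : ℂ) ^ (-s) -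
        g (Real.log n / L) * (n : ℂ) ^ (-s)‖ ≤
        A * ‖g (Real.log (n + 1 : ℕ) / L) - g (Real.log n / L)‖ +
          B * (‖s‖ * (n : ℝ) ^ (-s.re - 1)) := by
      intro n hn
      have hXn : X ≤ n := (mem_Ico.1 hn).1
      have hn1 : 1 ≤ n := hX.trans hXn
      have hsplit : g (Real.log (n + 1 : ℕ) / L) * ((n + 1 : ℕ) : ℂ) ^ (-s) -
          g (Real.log n / L) * (n : ℂ) ^ (-s) =
          (g (Real.log (n + 1 : ℕ) / L) - g (Real.log n / L)) * ((n + 1 : ℕ) : ℂ) ^ (-s) +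
            g (Real.log n / L) * (((n + 1 : ℕ) : ℂ) ^ (-s) - (n : ℂ) ^ (-s)) := by ring
      rw [hsplit]
      refine (norm_add_le _ _).trans (add_le_add ?_ ?_)
      · rw [norm_mul, mul_comm]
        exact mul_le_mul_of_nonneg_right (hnpow (n + 1) (by omega)) (norm_nonneg _)
      · rw [norm_mul]
        exact mul_le_mul (hgB _) (norm_natCast_succ_cpow_sub_le hn1 hs0 (by linarith))
          (norm_nonneg _) hB
    refine (sum_le_sum hpt).trans ?_
    rw [sum_add_distrib, ← mul_sum, ← mul_sum, ← mul_sum]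
    have hC := sum_Ico_rpow_neg_le hX hXY hσ
    calc A * ∑ n ∈ Ico X Y, ‖g (Real.log (n + 1 : ℕ) / L) - g (Real.log n / L)‖ +
          B * (‖s‖ * ∑ n ∈ Ico X Y, (n : ℝ) ^ (-s.re - 1))
        ≤ A * V + B * (‖s‖ * ((1 + 1 / s.re) * (X : ℝ) ^ (-s.re))) :=
          add_le_add (mul_le_mul_of_nonneg_left hvar hA0)
            (mul_le_mul_of_nonneg_left (mul_le_mul_of_nonneg_left hC (norm_nonneg _)) hB)
      _ = W := by rw [hW, hA]; ring
  have := norm_sum_Ioc_char_mul_le hq hθ (fun n => g (Real.log n / L) * (n : ℂ) ^ (-s))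
    hXY hAB hW0 hsup hvar'
  refine this.trans (le_of_eq ?_)
  rw [hW, hA]
  ring

/-- The discrete variation along `z_n = log n / L` (`L > 0`, `X ≥ 1`) over `X ≤ n < Y` is at most the total
variation of the profile on `[log X / L, log Y / L]`. [folklore] -/
private theorem ofReal_sum_Ico_norm_profile_sub_le_eVariationOn (g : ℝ → ℂ) {L : ℝ} (hL : 0 < L) {X : ℕ}
    (hX : 1 ≤ X) (Y : ℕ) :
    ENNReal.ofReal (∑ n ∈ Ico X Y, ‖g (Real.log (n + 1 : ℕ) / L) - g (Real.log n / L)‖) ≤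
      eVariationOn g (Set.Icc (Real.log X / L) (Real.log Y / L)) := by
  have hX0 : (0 : ℝ) < X := by exact_mod_cast hX
  -- the sample points `u n = log n / L` are monotone on `[X, Y]` and lie in the interval
  have hmono : MonotoneOn (fun n : ℕ => Real.log n / L) (Set.Icc X Y) := by
    intro i hi j _ hij
    refine div_le_div_of_nonneg_right (Real.log_le_log ?_ (by exact_mod_cast hij)) hL.le
    exact lt_of_lt_of_le hX0 (by exact_mod_cast hi.1)
  have hus : ∀ i ∈ Set.Icc X Y, (fun n : ℕ => Real.log n / L) i ∈
      Set.Icc (Real.log X / L) (Real.log Y / L) := by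
    intro i hi
    have h1 : (X : ℝ) ≤ i := by exact_mod_cast hi.1
    have h2 : (i : ℝ) ≤ Y := by exact_mod_cast hi.2
    exact ⟨div_le_div_of_nonneg_right (Real.log_le_log hX0 h1) hL.le,
      div_le_div_of_nonneg_right (Real.log_le_log (lt_of_lt_of_le hX0 h1) h2) hL.le⟩
  have key := eVariationOn.sum_le_of_monotoneOn_Icc (f := g) hmono hus
  refine le_trans (le_of_eq ?_) key
  rw [ENNReal.ofReal_sum_of_nonneg (fun _ _ => norm_nonneg _)]
  refine Finset.sum_congr rfl fun i _ => ?_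
  rw [edist_dist, dist_eq_norm]

/-- **Tail bound for a profile of bounded total variation** (the form a piecewise design profile supplies:
`sup ‖g‖ ≤ B`, total variation `≤ V` on `[log X/L, log Y/L]`; `L > 0`).
[cite: MontgomeryVaughan2007, Thm 9.18] -/
theorem norm_sum_Ioc_char_bvProfile_cpow_le_of_eVariationOn {q : ℕ} (hq : 2 ≤ q)
    {θ : DirichletCharacter ℂ q} (hθ : θ.IsPrimitive) (g : ℝ → ℂ) {B V : ℝ} (hB : 0 ≤ B) (hV : 0 ≤ V)
    (hgB : ∀ z, ‖g z‖ ≤ B) {L : ℝ} (hL : 0 < L) {s : ℂ} (hσ : 0 < s.re) {X Y : ℕ} (hX : 1 ≤ X)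
    (hXY : X ≤ Y) (hvar : eVariationOn g (Set.Icc (Real.log X / L) (Real.log Y / L)) ≤ ENNReal.ofReal V) :
    ‖∑ n ∈ Ioc X Y, θ n * (g (Real.log n / L) * (n : ℂ) ^ (-s))‖ ≤
      Real.sqrt q * (1 + Real.log q) * ((X : ℝ) ^ (-s.re) *
        (B * (1 + ‖s‖ * (1 + 1 / s.re)) + V)) := by
  refine norm_sum_Ioc_char_bvProfile_cpow_le hq hθ g hB hV hgB L hσ hX hXY ?_
  have h := (ofReal_sum_Ico_norm_profile_sub_le_eVariationOn g hL hX Y).trans hvar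
  exact (ENNReal.ofReal_le_ofReal_iff hV).1 h


end Literature.NumberTheory.LFunctions.Zhang2022.KnifeEdgeInvisibleTail
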